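import Literature.Computability.Complexity.PaulPippengerSzemerediTrotter1983Frames
import HarnessLib

/-!
# Height-block contents along a `TM2` run: an untouched height block does not change (PPST 1983, §3)

Literature / complexity toolkit, ninth brick of the inline formalization of
Paul–Pippenger–Szemerédi–Trotter 1983 (`PaulPippengerSzemerediTrotter1983.lean`, fact
`PaulEtAl1983_NTIME_not_subset_DTIME`; roadmap Layer 4, mathematical core, part 2). The
four-alternation protocol guesses, for a time block, the contents of the height blocks it touches
and checks them against the END contents of the LAST time block that touched each of them
(the edges of `TM2Blocks.depEdges`, `…Blocks.lean`). This is justified here for the true run: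
the content of a height block `B` of stack `k` does not change across a time block that does not
touch `B` (below the cut it is a hidden bottom carried along by `TM2Frames.run_append`; above the
highest touched block it does not exist at the block's boundaries), hence at the start of time
block `j` it is its content at the end of the last toucher of `B` before `j`, or its initial
content if there is none.

* `TM2Blocks.bpart β B S` — the cells of the stack word `S` (top first) at absolute heights
  `[B β, (B+1) β)`, listed bottom-up; `bpart_append_of_le`, `bpart_eq_nil_of_length_le`;
* `run_add` (runs compose), `eq_appendBot_split` (a configuration splits at any cuts),
  `loβ_add_le_minH'` (`lo · β + Q + b Q ≤ minH` as soon as `lo > 0`), `loβ_add_le_minH`,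
  `maxH_add_lt_hi_succ_mul`;
* **`bpart_run_succ_eq_of_not_touches`** — if time block `m` does not touch `B` on stack `k`
  then `bpart β B` of stack `k` is the same at times `m b` and `(m+1) b`;
* `bpart_run_eq_of_forall_not_touches`, **`bpart_run_eq_of_lastToucher`**,
  **`bpart_run_eq_init_of_lastToucher_none`** — at time `j b`, `bpart β B` of stack `k` is what
  it was at time `(i+1) b` for the last toucher `i` of `B` before `j`, and the initial one when no
  earlier time block touched `B`.

No named fact is introduced (definitions with bodies and theorems only).

## References

* W. J. Paul, N. Pippenger, E. Szemerédi, W. T. Trotter, *On determinism versus non-determinism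
  and related problems*, FOCS 1983, 429–438, §3 [PaulEtAl1983].
* R. Santhanam, *On separators, segregators and time versus space*, CCC 2001, §1 (p. 2: "there is
  an edge from vertex `i` to vertex `j` if … the machine scans some block of some tape during time
  interval `j` that was last scanned during time interval `i`") [Santhanam2001].
-/

namespace Literature.Computability.Complexity

open Turing Function

namespace TM2Blocks

/-! ### Cells of a height block -/

/-- The cells of the stack word `S` (top first) at absolute heights `[B β, (B+1) β)`, bottom-up.
[folklore] -/
def bpart {α : Type} (β B : ℕ) (S : List α) : List α :=
  (S.reverse.drop (B * β)).take β

/-- A height block inside the bottom part ignores the top part. [folklore] -/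
theorem bpart_append_of_le {α : Type} {β B : ℕ} (U L : List α) (h : (B + 1) * β ≤ L.length) :
    bpart β B (U ++ L) = bpart β B L := by
  unfold bpart
  rw [Nat.succ_mul] at h
  have h1 : B * β ≤ L.reverse.length := by rw [List.length_reverse]; omega
  rw [List.reverse_append, List.drop_append_of_le_length h1, List.take_append_of_le_length]
  rw [List.length_drop, List.length_reverse]
  omega

/-- A height block above the top is empty. [folklore] -/
theorem bpart_eq_nil_of_length_le {α : Type} {β B : ℕ} (S : List α) (h : S.length ≤ B * β) :
    bpart β B S = [] := by
  unfold bpart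
  rw [List.drop_eq_nil_of_le (by rw [List.length_reverse]; exact h), List.take_nil]

variable {tm : FinTM2}

/-! ### Runs compose; configurations split -/

/-- Runs compose: `run c₀ (s + t) = run (run c₀ s) t`. [folklore] -/
theorem run_add (c₀ : tm.Cfg) (s t : ℕ) : run tm c₀ (s + t) = run tm (run tm c₀ s) t := by
  unfold run
  rw [Nat.add_comm, Function.iterate_add_apply]

/-- A configuration is the appended-bottom form of its own top segments, for any cuts `θ`
(the bottom `min (θ k) |stack|` cells hidden). [folklore] -/
theorem eq_appendBot_split (d : tm.Cfg) (θ : tm.K → ℕ) :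
    d = TM2Frames.appendBot (fun k => (d.stk k).drop ((d.stk k).length - θ k))
      ⟨d.l, d.var, fun k => (d.stk k).take ((d.stk k).length - θ k)⟩ := by
  obtain ⟨l, v, S⟩ := d
  simp only [TM2Frames.appendBot_mk]
  congr 1
  funext k
  exact (List.take_append_drop _ _).symm

/-! ### The cut of a time block lies below its heights -/

/-- `lo β + Q + b Q ≤ minH` when `lo > 0`: the cut is positive only when it leaves room for
`b` steps of pops above it. [folklore] -/
theorem loβ_add_le_minH' (c₀ : tm.Cfg) (b : ℕ) (k : tm.K) (m : ℕ) (h : 0 < lo tm c₀ b k m) :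
    lo tm c₀ b k m * blockβ tm b + TM2Comp.machinePopBound tm + b * TM2Comp.machinePopBound tm ≤
      minH tm c₀ b k m := by
  have h1 : lo tm c₀ b k m * blockβ tm b ≤
      minH tm c₀ b k m - TM2Comp.machinePopBound tm - b * TM2Comp.machinePopBound tm := by
    unfold lo; exact Nat.div_mul_le_self _ _
  have h2 : 0 < minH tm c₀ b k m - TM2Comp.machinePopBound tm - b * TM2Comp.machinePopBound tm := by
    have hβ : 0 < blockβ tm b := Nat.succ_pos _
    have : 1 * blockβ tm b ≤ lo tm c₀ b k m * blockβ tm b := Nat.mul_le_mul_right _ h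
    omega
  omega

/-- `lo β + Q ≤ minH` when `lo > 0`. [folklore] -/
theorem loβ_add_le_minH (c₀ : tm.Cfg) (b : ℕ) (k : tm.K) (m : ℕ) (h : 0 < lo tm c₀ b k m) :
    lo tm c₀ b k m * blockβ tm b + TM2Comp.machinePopBound tm ≤ minH tm c₀ b k m := by
  have := loβ_add_le_minH' c₀ b k m h; omega

/-- `maxH + P < (hi + 1) β`. [folklore] -/
theorem maxH_add_lt_hi_succ_mul (c₀ : tm.Cfg) (b : ℕ) (k : tm.K) (m : ℕ) :
    maxH tm c₀ b k m + TM2Comp.machinePushBound tm < (hi tm c₀ b k m + 1) * blockβ tm b := by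
  unfold hi
  rw [Nat.succ_mul]
  exact Nat.lt_div_mul_add (Nat.succ_pos _)

/-- Heights inside time block `m` are at least `minH m`. [folklore] -/
theorem height_block_ge_minH (c₀ : tm.Cfg) (b : ℕ) (k : tm.K) (m t : ℕ) (ht : t ≤ b) :
    minH tm c₀ b k m ≤ ((run tm c₀ (m * b + t)).stk k).length :=
  minH_le_height c₀ b k m t ht

/-- Boundary heights of time block `m` are at most `maxH m`. [folklore] -/
theorem length_run_block_le_maxH (c₀ : tm.Cfg) (b : ℕ) (k : tm.K) (m t : ℕ) (ht : t ≤ b) :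
    ((run tm c₀ (m * b + t)).stk k).length ≤ maxH tm c₀ b k m :=
  height_le_maxH c₀ b k m t ht

/-! ### An untouched height block does not change across a time block -/

/-- **Untouched height blocks are frozen.** If time block `m` does not touch the height block `B`
of stack `k` (`B < lo` or `hi < B`), the cells of `B` are the same at the two boundaries `m b` and
`(m+1) b` of the block: below the cut they are a hidden bottom carried along (`run_append`, the
room `Q` being guaranteed by `minH`), above `maxH + P` they do not exist at the boundaries.
[cite: PaulEtAl1983, §3] [cite: Santhanam2001, §1 (p. 2)] -/
theorem bpart_run_succ_eq_of_not_touches (c₀ : tm.Cfg) (b : ℕ) (k : tm.K) (m B : ℕ)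
    (hnt : ¬ Touches (lo tm c₀ b k) (hi tm c₀ b k) m B) :
    bpart (blockβ tm b) B ((run tm c₀ ((m + 1) * b)).stk k) =
      bpart (blockβ tm b) B ((run tm c₀ (m * b)).stk k) := by
  letI := tm.kDecidableEq
  simp only [Touches, not_and_or, not_le] at hnt
  rcases hnt with hB | hB
  · -- `B < lo`: a hidden bottom
    set d := run tm c₀ (m * b) with hd
    let θ : tm.K → ℕ := fun k' => lo tm c₀ b k' m * blockβ tm b
    let L : ∀ k', List (tm.Γ k') := fun k' => (d.stk k').drop ((d.stk k').length - θ k')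
    let c : tm.Cfg := ⟨d.l, d.var, fun k' => (d.stk k').take ((d.stk k').length - θ k')⟩
    have hsplit : d = TM2Frames.appendBot L c := eq_appendBot_split d θ
    -- heights at the block start dominate the cuts
    have hθle : ∀ k', θ k' ≤ (d.stk k').length := fun k' => by
      have h0 := height_block_ge_minH c₀ b k' m 0 (Nat.zero_le _)
      rw [Nat.add_zero, ← hd] at h0
      rcases Nat.eq_zero_or_pos (lo tm c₀ b k' m) with hz | hz
      · simp [θ, hz]
      · have := loβ_add_le_minH c₀ b k' m hz
        simp only [θ]; omega
    have hL : ∀ k', (L k').length = θ k' := fun k' => by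
      simp only [L, List.length_drop]; have := hθle k'; omega
    -- the room condition along the block
    have hroom : ∀ t, t < b → ∀ k', L k' ≠ [] →
        TM2Comp.machinePopBound tm + (L k').length ≤
          ((run tm (TM2Frames.appendBot L c) t).stk k').length := by
      intro t ht k' hk'
      rw [← hsplit, hd, ← run_add]
      have hpos : 0 < lo tm c₀ b k' m := by
        by_contra h0
        have h0 : lo tm c₀ b k' m = 0 := by omega
        apply hk'
        apply List.eq_nil_of_length_eq_zero
        rw [hL]; simp [θ, h0]
      have h1 := loβ_add_le_minH c₀ b k' m hpos
      have h2 := height_block_ge_minH c₀ b k' m t ht.le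
      rw [hL]; simp only [θ]; omega
    have happ := TM2Frames.run_append c L b hroom b le_rfl
    rw [← hsplit, hd, ← run_add, show m * b + b = (m + 1) * b by ring] at happ
    rw [happ, TM2Frames.appendBot_stk]
    have hLk : (B + 1) * blockβ tm b ≤ (L k).length := by
      rw [hL]; exact Nat.mul_le_mul_right _ hB
    rw [bpart_append_of_le _ _ hLk]
    conv_rhs => rw [show d.stk k = c.stk k ++ L k from (List.take_append_drop _ _).symm]
    rw [bpart_append_of_le _ _ hLk]
  · -- `hi < B`: above the top at both boundaries
    have h1 := maxH_add_lt_hi_succ_mul c₀ b k m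
    have hBβ : (hi tm c₀ b k m + 1) * blockβ tm b ≤ B * blockβ tm b := Nat.mul_le_mul_right _ hB
    have e0 : bpart (blockβ tm b) B ((run tm c₀ (m * b)).stk k) = [] := by
      apply bpart_eq_nil_of_length_le
      have := length_run_block_le_maxH c₀ b k m 0 (Nat.zero_le _)
      rw [Nat.add_zero] at this
      omega
    have e1 : bpart (blockβ tm b) B ((run tm c₀ ((m + 1) * b)).stk k) = [] := by
      apply bpart_eq_nil_of_length_le
      have := length_run_block_le_maxH c₀ b k m b le_rfl
      rw [show m * b + b = (m + 1) * b by ring] at this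
      omega
    rw [e0, e1]

/-! ### The content of a height block at a time block's start -/

/-- Over a stretch of time blocks none of which touches `B`, the cells of `B` do not change.
[folklore] -/
theorem bpart_run_eq_of_forall_not_touches (c₀ : tm.Cfg) (b : ℕ) (k : tm.K) (B i : ℕ) :
    ∀ d : ℕ, (∀ m, i ≤ m → m < i + d → ¬ Touches (lo tm c₀ b k) (hi tm c₀ b k) m B) →
      bpart (blockβ tm b) B ((run tm c₀ ((i + d) * b)).stk k) =
        bpart (blockβ tm b) B ((run tm c₀ (i * b)).stk k)
  | 0, _ => by simp
  | d + 1, h => by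
    have h1 := bpart_run_succ_eq_of_not_touches c₀ b k (i + d) B (h (i + d) (by omega) (by omega))
    rw [show i + (d + 1) = i + d + 1 by ring, h1]
    exact bpart_run_eq_of_forall_not_touches c₀ b k B i d fun m hm hm' => h m hm (by omega)

/-- **The last toucher determines the content.** If `i` is the last time block before `j` touching
the height block `B` of stack `k`, then at time `j b` the cells of `B` are those at time
`(i+1) b`, the end of block `i` (the edge `i → j` of the dependency graph).
[cite: Santhanam2001, §1 (p. 2)] [cite: PaulEtAl1983, §3] -/
theorem bpart_run_eq_of_lastToucher (c₀ : tm.Cfg) (b : ℕ) (k : tm.K) {j B i : ℕ}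
    (h : lastToucher (lo tm c₀ b k) (hi tm c₀ b k) j B = some i) :
    bpart (blockβ tm b) B ((run tm c₀ (j * b)).stk k) =
      bpart (blockβ tm b) B ((run tm c₀ ((i + 1) * b)).stk k) := by
  obtain ⟨hij, -, hno⟩ := lastToucher_spec h
  have := bpart_run_eq_of_forall_not_touches c₀ b k B (i + 1) (j - (i + 1))
    fun m hm hm' => hno m (by omega) (by omega)
  rwa [show i + 1 + (j - (i + 1)) = j by omega] at this

/-- No last toucher: no earlier time block touches `B`. [folklore] -/
theorem forall_not_touches_of_lastToucher_none {lo hi : ℕ → ℕ} {j B : ℕ}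
    (h : lastToucher lo hi j B = none) : ∀ m, m < j → ¬ Touches lo hi m B := by
  intro m hm hmB
  unfold lastToucher at h
  have h' : ((Finset.range j).filter fun i => Touches lo hi i B).max = ⊥ := h
  rw [Finset.max_eq_bot] at h'
  have : m ∈ (Finset.range j).filter fun i => Touches lo hi i B := by simp [hm, hmB]
  rw [h'] at this
  simp at this

/-- **No earlier toucher: the initial content.** If no time block before `j` touches the height
block `B` of stack `k`, then at time `j b` the cells of `B` are the initial ones.
[cite: PaulEtAl1983, §3] -/
theorem bpart_run_eq_init_of_lastToucher_none (c₀ : tm.Cfg) (b : ℕ) (k : tm.K) {j B : ℕ}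
    (h : lastToucher (lo tm c₀ b k) (hi tm c₀ b k) j B = none) :
    bpart (blockβ tm b) B ((run tm c₀ (j * b)).stk k) = bpart (blockβ tm b) B (c₀.stk k) := by
  have hno := forall_not_touches_of_lastToucher_none h
  have := bpart_run_eq_of_forall_not_touches c₀ b k B 0 j fun m _ hm' => hno m (by omega)
  simpa [run] using this

end TM2Blocks

end Literature.Computability.Complexity
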